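import Literature.Analysis.FluidPDE.NSLocalAnalyticityRadiusRepresentation
import Literature.Analysis.FluidPDE.KatoLocalBoundedPicard
import HarnessLib

/-!
# Bradshaw–Grujić–Kukavica local analyticity radius: the datum of the localised Picard scheme

Analysis/FluidPDE definitions-layer file (namespace `Literature.Analysis.FluidPDE.BGK2015`) for
the proof of the named fact
`Literature.Analysis.FluidPDE.bradshawGrujicKukavica2015_local_analyticity_radius`
(Bradshaw–Grujić–Kukavica 2015, Thm. 2.3, §4). From the Oseen representation of the localised
velocity `v = χu` (`NSLocalAnalyticityRadiusRepresentation.locVelocity_eq_representation`),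

  `v(t) = b(t) + e^{(t-s₀)Δ}a(s₀) - B_{s₀}(v, ũ)(t) - B_{s₀}(2∇χ, ũ)(t) + F(t)`,

and the pointwise splitting `ũ = v + (1 - χ)ũ` of the bounded extension, we isolate the genuinely
nonlinear term: with the **datum**

  `DATA(t) = locData = b(t) + e^{(t-s₀)Δ}a(s₀) - B_{s₀}(v, (1-χ)ũ)(t) - B_{s₀}(2∇χ, ũ)(t) + F(t)`

(every term of which is either a far-field/annular integral or a free caloric term, hence
continues holomorphically near the inner ball — `NSLocalAnalyticityRadiusDataComplex.lean`), the
localised velocity solves the fixed-point equation of the bounded Picard scheme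

  `v(t) = DATA(t) - B_{s₀}(v, v)(t)`      (`locVelocity_eq_locData_sub`, `-δ < s₀ < t < R²`).

We also record the joint measurability of `DATA` on slabs and its bound
`‖DATA‖ ≤ M_v + C M_v² · 2√(t - s₀)` in terms of a bound `M_v` for `v`
(`norm_locData_le`), through the identity `DATA = v + B_{s₀}(v, v)`.

## References

* Z. Bradshaw, Z. Grujić, I. Kukavica, J. Differential Equations 259 (2015), §4, (4.2)–(4.4).
  [BradshawGrujicKukavica2015]
* P. G. Lemarié-Rieusset, *The Navier–Stokes Problem in the 21st Century* (2016), Thm. 9.12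
  (proof). [LemarieRieusset2016]
-/

noncomputable section

open MeasureTheory Set Function Filter Metric Real
open _root_.Topology
open scoped ENNReal ContDiff InnerProductSpace RealInnerProductSpace

namespace Literature.Analysis.FluidPDE

namespace BGK2015

variable {x₁ : EuclideanSpace ℝ (Fin 3)} {δ R : ℝ}
  {u : ℝ → EuclideanSpace ℝ (Fin 3) → EuclideanSpace ℝ (Fin 3)}
  {p : ℝ → EuclideanSpace ℝ (Fin 3) → ℝ} {χ : EuclideanSpace ℝ (Fin 3) → ℝ}

/-! ### The far part of the extension and the datum -/

/-- **The far part of the bounded extension**, `(1 - χ)ũ`: supported off the inner region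
`{χ = 1} ⊇ B̄(x₁, R - 4)`. [folklore] -/
def locFarVelocity (x₁ : EuclideanSpace ℝ (Fin 3)) (R : ℝ) (χ : EuclideanSpace ℝ (Fin 3) → ℝ)
    (u : ℝ → EuclideanSpace ℝ (Fin 3) → EuclideanSpace ℝ (Fin 3)) (t : ℝ)
    (y : EuclideanSpace ℝ (Fin 3)) : EuclideanSpace ℝ (Fin 3) :=
  (1 - χ y) • locExtension x₁ R u t y

/-- **The datum of the localised Picard scheme**,
`DATA(t) = b(t) + e^{(t-s₀)Δ}a(s₀) - B_{s₀}(v, (1-χ)ũ)(t) - B_{s₀}(2∇χ, ũ)(t) + F(t)`.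
[cite: BradshawGrujicKukavica2015, §4 (4.2)–(4.4)] -/
def locData (x₁ : EuclideanSpace ℝ (Fin 3)) (R : ℝ) (χ : EuclideanSpace ℝ (Fin 3) → ℝ)
    (u : ℝ → EuclideanSpace ℝ (Fin 3) → EuclideanSpace ℝ (Fin 3))
    (p : ℝ → EuclideanSpace ℝ (Fin 3) → ℝ) (s₀ t : ℝ) (x : EuclideanSpace ℝ (Fin 3)) :
    EuclideanSpace ℝ (Fin 3) :=
  locGradPart χ u t x + locDatum χ u s₀ t x
    - oseenDuhamel 1 s₀ (locVelocity χ u) (locFarVelocity x₁ R χ u) t x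
    - oseenDuhamel 1 s₀ (fun _ y => (2 : ℝ) • gradient χ y) (locExtension x₁ R u) t x
    + locForcing χ u p s₀ t x

/-- Unfolding lemma. [folklore] -/
theorem locFarVelocity_apply (t : ℝ) (y : EuclideanSpace ℝ (Fin 3)) :
    locFarVelocity x₁ R χ u t y = (1 - χ y) • locExtension x₁ R u t y := rfl

/-- Unfolding lemma. [folklore] -/
theorem locData_apply (s₀ t : ℝ) (x : EuclideanSpace ℝ (Fin 3)) :
    locData x₁ R χ u p s₀ t x = locGradPart χ u t x + locDatum χ u s₀ t x
      - oseenDuhamel 1 s₀ (locVelocity χ u) (locFarVelocity x₁ R χ u) t x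
      - oseenDuhamel 1 s₀ (fun _ y => (2 : ℝ) • gradient χ y) (locExtension x₁ R u) t x
      + locForcing χ u p s₀ t x := rfl

/-- **The splitting of the extension**: `ũ = v + (1 - χ)ũ` pointwise (`χ` is supported in
`B̄(x₁, R - 3) ⊆ B(x₁, R - 2)`, where `ũ = u`). [folklore] -/
theorem locExtension_eq_locVelocity_add_far (hχ : IsLocCutoff x₁ R χ) (t : ℝ) (y : EuclideanSpace ℝ (Fin 3)) :
    locExtension x₁ R u t y = locVelocity χ u t y + locFarVelocity x₁ R χ u t y := by
  rw [locFarVelocity_apply, locVelocity_apply]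
  by_cases hy : y ∈ ball x₁ (R - 2)
  · rw [locExtension_of_mem hy, sub_smul, one_smul, add_sub_cancel]
  · rw [locExtension_of_notMem hy, smul_zero, add_zero]
    have hχ0 : χ y = 0 := by
      refine image_eq_zero_of_notMem_tsupport fun h => hy ?_
      exact (closedBall_subset_ball (by linarith)) (hχ.tsupport_subset h)
    rw [hχ0, zero_smul]

/-- The far part is the difference `ũ - v`. [folklore] -/
theorem locFarVelocity_eq_sub (hχ : IsLocCutoff x₁ R χ) (t : ℝ) (y : EuclideanSpace ℝ (Fin 3)) :
    locFarVelocity x₁ R χ u t y = locExtension x₁ R u t y - locVelocity χ u t y := by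
  rw [locExtension_eq_locVelocity_add_far hχ, add_sub_cancel_left]

/-- **The far part vanishes on `B̄(x₁, R - 4)`** (where `χ = 1`). [folklore] -/
theorem locFarVelocity_eq_zero_of_mem (hχ : IsLocCutoff x₁ R χ) {y : EuclideanSpace ℝ (Fin 3)}
    (hy : y ∈ closedBall x₁ (R - 4)) (t : ℝ) : locFarVelocity x₁ R χ u t y = 0 := by
  rw [locFarVelocity_apply, hχ.eq_one y hy, sub_self, zero_smul]

/-- A bound for the far part from a bound for the extension. [folklore] -/
theorem norm_locFarVelocity_le (hχ : IsLocCutoff x₁ R χ) (t : ℝ) (y : EuclideanSpace ℝ (Fin 3)) :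
    ‖locFarVelocity x₁ R χ u t y‖ ≤ ‖locExtension x₁ R u t y‖ := by
  rw [locFarVelocity_apply, norm_smul, Real.norm_eq_abs]
  refine mul_le_of_le_one_left (norm_nonneg _) ?_
  rw [abs_le]
  exact ⟨by linarith [hχ.le_one y], by linarith [hχ.nonneg y]⟩

/-! ### Slab measurability and bounds -/

section Slab

variable (hsol : IsCylinderSolution x₁ δ R u p) (hχ : IsLocCutoff x₁ R χ) {s₀ t₁ : ℝ}
  (hI : Icc s₀ t₁ ⊆ Ioo (-δ) (R ^ 2))
include hsol hχ hI

/-- The far part is a.e. strongly measurable on the slab `(s₀, t₁) × ℝ³`. [folklore] -/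
theorem aestronglyMeasurable_uncurry_locFarVelocity :
    AEStronglyMeasurable (uncurry (locFarVelocity x₁ R χ u))
      ((volume : Measure (ℝ × EuclideanSpace ℝ (Fin 3))).restrict (Ioo s₀ t₁ ×ˢ univ)) := by
  have h1 := aestronglyMeasurable_uncurry_locExtension hsol hI (s₀ := s₀) (t := t₁)
  have h2 := aestronglyMeasurable_uncurry_locVelocity hsol hχ hI (s₀ := s₀) (t := t₁)
  refine (h1.sub h2).congr (Eventually.of_forall fun z => ?_)
  show locExtension x₁ R u z.1 z.2 - locVelocity χ u z.1 z.2 = locFarVelocity x₁ R χ u z.1 z.2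
  rw [locFarVelocity_eq_sub hχ]

end Slab

/-! ### The fixed-point identity -/

/-- **The localised velocity solves the Picard fixed-point equation with datum `DATA`**:
for `-δ < s₀ < t < R²` and every `x`, `v(t, x) = DATA(t, x) - B_{s₀}(v, v)(t, x)`.
[cite: BradshawGrujicKukavica2015, §4 (4.2)–(4.4)] -/
theorem locVelocity_eq_locData_sub (hsol : IsCylinderSolution x₁ δ R u p) (hχ : IsLocCutoff x₁ R χ)
    {s₀ t : ℝ} (hs₀ : -δ < s₀) (hst : s₀ < t) (htR : t < R ^ 2) (x : EuclideanSpace ℝ (Fin 3)) :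
    locVelocity χ u t x = locData x₁ R χ u p s₀ t x
      - oseenDuhamel 1 s₀ (locVelocity χ u) (locVelocity χ u) t x := by
  have hrep := locVelocity_eq_representation hsol hχ hs₀ hst.le htR x
  -- slab data on `(s₀, t)`
  have hI : Icc s₀ t ⊆ Ioo (-δ) (R ^ 2) := fun s hs => ⟨hs₀.trans_le hs.1, hs.2.trans_lt htR⟩
  obtain ⟨Mv, -, hMv⟩ := exists_forall_norm_locVelocity_le hsol hχ hI
  obtain ⟨Me, -, hMe⟩ := exists_forall_norm_locExtension_le hsol hI (x₁ := x₁)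
  have hmv := aestronglyMeasurable_uncurry_locVelocity hsol hχ hI (s₀ := s₀) (t := t)
  have hme := aestronglyMeasurable_uncurry_locExtension hsol hI (s₀ := s₀) (t := t) (x₁ := x₁)
  -- `B(v, ũ) - B(v, v) = B(v, ũ - v) = B(v, (1-χ)ũ)`
  have hsub := oseenDuhamel_sub_right (ν := 1) (s := s₀) (T := t) one_pos hmv hme hmv
    (fun τ hτ y => hMv τ (Ioo_subset_Icc_self hτ) y) (fun τ hτ y => hMe τ (Ioo_subset_Icc_self hτ) y)
    (fun τ hτ y => hMv τ (Ioo_subset_Icc_self hτ) y) hst le_rfl x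
  have hfar : oseenDuhamel 1 s₀ (locVelocity χ u) (locFarVelocity x₁ R χ u) t x =
      oseenDuhamel 1 s₀ (locVelocity χ u) (locExtension x₁ R u) t x -
        oseenDuhamel 1 s₀ (locVelocity χ u) (locVelocity χ u) t x := by
    rw [← hsub]
    congr 1
    funext τ y
    exact locFarVelocity_eq_sub hχ τ y
  rw [locData_apply, hfar, hrep]
  abel

/-- **`DATA = v + B_{s₀}(v, v)`** for `-δ < s₀ < t < R²`. [folklore] -/
theorem locData_eq_add (hsol : IsCylinderSolution x₁ δ R u p) (hχ : IsLocCutoff x₁ R χ)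
    {s₀ t : ℝ} (hs₀ : -δ < s₀) (hst : s₀ < t) (htR : t < R ^ 2) (x : EuclideanSpace ℝ (Fin 3)) :
    locData x₁ R χ u p s₀ t x = locVelocity χ u t x
      + oseenDuhamel 1 s₀ (locVelocity χ u) (locVelocity χ u) t x := by
  rw [locVelocity_eq_locData_sub hsol hχ hs₀ hst htR x, sub_add_cancel]

/-! ### Measurability and size of the datum on slabs -/

section DataSlab

variable (hsol : IsCylinderSolution x₁ δ R u p) (hχ : IsLocCutoff x₁ R χ) {s₀ t₁ : ℝ}
  (hs₀ : -δ < s₀) (ht₁ : t₁ < R ^ 2)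
include hsol hχ hs₀ ht₁

/-- **The datum is jointly a.e. strongly measurable on the slab `(s₀, t₁) × ℝ³`** (as
`v + B_{s₀}(v, v)` there). [folklore] -/
theorem aestronglyMeasurable_uncurry_locData :
    AEStronglyMeasurable (uncurry (locData x₁ R χ u p s₀))
      ((volume : Measure (ℝ × EuclideanSpace ℝ (Fin 3))).restrict (Ioo s₀ t₁ ×ˢ univ)) := by
  rcases le_or_gt t₁ s₀ with hle | hlt
  · rw [Ioo_eq_empty (not_lt.2 hle), empty_prod, Measure.restrict_empty]
    exact aestronglyMeasurable_zero_measure _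
  have hI : Icc s₀ t₁ ⊆ Ioo (-δ) (R ^ 2) := fun s hs => ⟨hs₀.trans_le hs.1, hs.2.trans_lt ht₁⟩
  obtain ⟨Mv, -, hMv⟩ := exists_forall_norm_locVelocity_le hsol hχ hI
  have hmv := aestronglyMeasurable_uncurry_locVelocity hsol hχ hI (s₀ := s₀) (t := t₁)
  have hB := aestronglyMeasurable_uncurry_oseenDuhamel (ν := 1) (s := s₀) (T := t₁) one_pos hmv hmv
    (fun τ hτ y => hMv τ (Ioo_subset_Icc_self hτ) y) (fun τ hτ y => hMv τ (Ioo_subset_Icc_self hτ) y)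
  refine (hmv.add hB).congr ?_
  refine (ae_restrict_iff' (measurableSet_Ioo.prod MeasurableSet.univ)).2 (Eventually.of_forall fun z hz => ?_)
  show locVelocity χ u z.1 z.2 + oseenDuhamel 1 s₀ (locVelocity χ u) (locVelocity χ u) z.1 z.2 =
    locData x₁ R χ u p s₀ z.1 z.2
  rw [locData_eq_add hsol hχ hs₀ (mem_prod.1 hz).1.1 ((mem_prod.1 hz).1.2.trans ht₁)]

/-- **Size of the datum**: if `‖v(s, y)‖ ≤ M_v` on `(s₀, t₁) × ℝ³` then, with the absolute
constant `C` of `exists_norm_oseenDuhamel_le_mul`,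
`‖DATA(t, x)‖ ≤ M_v + C M_v² · 2√(t - s₀)` for `s₀ < t < t₁`… precisely for `t ∈ (s₀, t₁)`.
[cite: LemarieRieusset2016, Thm. 9.12 (proof)] -/
theorem norm_locData_le {C : ℝ}
    (hCB : ∀ {u v : ℝ → EuclideanSpace ℝ (Fin 3) → EuclideanSpace ℝ (Fin 3)} {s t Mu Mv : ℝ}, s < t →
      0 ≤ Mu → 0 ≤ Mv → (∀ τ ∈ Ioo s t, ∀ y, ‖u τ y‖ ≤ Mu) → (∀ τ ∈ Ioo s t, ∀ y, ‖v τ y‖ ≤ Mv) →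
      ∀ x, ‖oseenDuhamel 1 s u v t x‖ ≤ C * Mu * Mv * (1 : ℝ) ^ (-(1 / 2 : ℝ)) * (2 * Real.sqrt (t - s)))
    {Mv : ℝ} (hMv0 : 0 ≤ Mv) (hMv : ∀ s ∈ Ioo s₀ t₁, ∀ y, ‖locVelocity χ u s y‖ ≤ Mv)
    {t : ℝ} (ht : t ∈ Ioo s₀ t₁) (x : EuclideanSpace ℝ (Fin 3)) :
    ‖locData x₁ R χ u p s₀ t x‖ ≤ Mv + C * Mv ^ 2 * (2 * Real.sqrt (t - s₀)) := by
  rw [locData_eq_add hsol hχ hs₀ ht.1 (ht.2.trans ht₁) x]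
  refine (norm_add_le _ _).trans (add_le_add (hMv t ht x) ?_)
  have h := hCB ht.1 hMv0 hMv0 (fun τ hτ y => hMv τ ⟨hτ.1, hτ.2.trans ht.2⟩ y)
    (fun τ hτ y => hMv τ ⟨hτ.1, hτ.2.trans ht.2⟩ y) x
  rw [Real.one_rpow, mul_one] at h
  calc _ ≤ C * Mv * Mv * (2 * Real.sqrt (t - s₀)) := h
    _ = C * Mv ^ 2 * (2 * Real.sqrt (t - s₀)) := by ring

end DataSlab

end BGK2015

end Literature.Analysis.FluidPDE
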